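/-
Copyright (c) 2026. All rights reserved.
Released under Apache 2.0 license as described in the file LICENSE.
Authors: solo-Langlands-informed (ideation tier, family 6).
-/
import Literature.NumberTheory.GaloisRepresentations.LocalKroneckerWeberContinuousCharacters
import Literature.NumberTheory.GaloisRepresentations.LubinTateReciprocity
import HarnessLib

/-!
# Local Kronecker–Weber for continuous characters of an arbitrary `p`-adic field, through the
# Lubin–Tate character

`Proofs`-style file (theorems only: no definition, no named fact, no instance).  Topic
`NumberTheory/GaloisRepresentations`; namespace
`Literature.NumberTheory.GaloisRepresentations.LocalKroneckerWeberLT`.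

**What is printed.**  Lubin–Tate (1965, Thm. 3 and Cor.) and Serre (Cassels–Fröhlich Ch. VI §3.7
Thm. 3): for a non-archimedean local field `F` with uniformiser `π`, `F^{ab} = F^{nr} · F_π` with
`F_π = ⋃ F(𝔪-torsion of the Lubin–Tate module)` totally ramified with group `𝒪_Fˣ`, and on the inertia
group the Artin map is read off by the Lubin–Tate character.  For CHARACTERS this says: a continuous
homomorphism `ψ : Γ_F → A` to a Hausdorff abelian group is trivial on `I_F ∩ ker χ_π`, `χ_π(I_F) = 𝒪_Fˣ`,
and `ψ = μ · ν` with `μ` unramified and `ν = ν̃ ∘ χ_π` for a continuous homomorphism `ν̃ : 𝒪_Fˣ → A`.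
The case `F ≅ ℚ_ℓ`, `χ_π = χ_ℓ` is `LocalKroneckerWeberContinuousCharacters.lean`; the present file
is its transplant to every `F`, with the tree's Lubin–Tate character `lubinTateChar hπ : Γ_F → 𝒪_Fˣ`
(`LubinTateCharacterLimit`) and Lubin–Tate reciprocity for THE Artin map
(`coe_lubinTateChar_toAbsGalois_canonicalArtin`: `χ_π(w) = Art_F(w)` for `w ∈ I_F`).

**What is proved here** (`F` any non-archimedean local field, `π` any uniformiser):
* `canonicalArtin_eq_one_of_lubinTateChar_eq_one` — `w ∈ I_F`, `χ_π(w) = 1 ⇒ Art_F(w) = 1`;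
* `eq_one_of_mem_absInertia_of_lubinTateChar_eq_one` — **local Kronecker–Weber for continuous
  characters**: `ψ(σ) = 1` for `σ ∈ I_F ∩ ker χ_π`; `apply_eq_of_mem_absInertia_of_lubinTateChar_eq`;
* `exists_mem_weilInertia_lubinTateChar_eq` / `exists_mem_absInertia_lubinTateChar_eq` —
  `χ_π(I_F) = 𝒪_Fˣ`;
* `exists_continuous_character_eq_on_absInertia` — the inertial part `ν` of `ψ` (equal to `ψ` on
  `I_F`, trivial on `ker χ_π`); `exists_unramified_mul_inertial` — `ψ = μ · ν`;
* `exists_continuous_unitsHom_eq_comp_lubinTateChar` — a continuous character trivial on `ker χ_π`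
  factors as `ν̃ ∘ χ_π` with `ν̃ : 𝒪_Fˣ →* A` continuous (`χ_π : Γ_F ↠ 𝒪_Fˣ` is a quotient map:
  a continuous surjection from a compact space to a Hausdorff space);
* `exists_unramified_mul_unitsHom_comp_lubinTateChar` — the decomposition
  `ψ(σ) = μ(σ) · ν̃(χ_π(σ))` with `μ` unramified, and `ψ(w) = ν̃(Art_F(w))` read on `w ∈ I_F ⊆ W_F`.

## References
* J. Lubin, J. Tate, *Formal complex multiplication in local fields*, Ann. of Math. 81 (1965),
  Thm. 3 and Corollary.  [`LubinTate1965`]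
* J.-P. Serre, *Local class field theory*, Ch. VI of Cassels–Fröhlich (1967), §3.4 Thm. 3, §3.7
  Thm. 3.  [`CasselsFrohlichANT1967`]
* J.-P. Serre, *Local Fields*, GTM 67 (1979), Ch. XIII §4 Thm. 1–2.  [`SerreLocalFields1979`]
-/

noncomputable section

open scoped ValuativeRel
open ValuativeRel

namespace Literature.NumberTheory.GaloisRepresentations

open GaloisRepresentations.IsNonarchimedeanLocalField Field

namespace LocalKroneckerWeberLT

variable {F : Type} [Field F] [ValuativeRel F] [TopologicalSpace F] [IsNonarchimedeanLocalField F]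
  {π : 𝒪[F]} (hπ : (valuation F).IsUniformizer (π : F))

include hπ in
/-- **`Art_F(w) = 1` for `w ∈ I_F ∩ ker χ_π`**: on inertia `Art_F(w) = χ_π(w)` (Lubin–Tate
reciprocity for THE Artin map, tree `coe_lubinTateChar_toAbsGalois_canonicalArtin`).
[cite: CasselsFrohlichANT1967, Ch. VI §3.7 Thm. 3] [cite: LubinTate1965, Thm. 3] -/
theorem canonicalArtin_eq_one_of_lubinTateChar_eq_one {w : WeilGroup F}
    (hw : w ∈ WeilGroup.inertia F) (hχ : lubinTateChar hπ (WeilGroup.toAbsGalois F w) = 1) :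
    canonicalArtin F w = 1 := by
  have h := coe_lubinTateChar_toAbsGalois_canonicalArtin hπ hw
  rw [hχ, Units.val_one, OneMemClass.coe_one] at h
  exact Units.val_eq_one.mp h.symm

include hπ in
/-- **Local Kronecker–Weber, Weil-group form**: a continuous character `ψ : Γ_F → A` (`A` a `T₁`
abelian topological group) is trivial on every `w ∈ I_F` with `χ_π(w) = 1`.
[cite: CasselsFrohlichANT1967, Ch. VI §3.7 Thm. 3] [cite: SerreLocalFields1979, Ch. XIII §4 Thm. 2] -/
theorem eq_one_of_mem_inertia_of_lubinTateChar_eq_one {A : Type*} [CommGroup A]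
    [TopologicalSpace A] [T1Space A] (ψ : absoluteGaloisGroup F →* A) (hψ : Continuous ψ)
    {w : WeilGroup F} (hw : w ∈ WeilGroup.inertia F)
    (hχ : lubinTateChar hπ (WeilGroup.toAbsGalois F w) = 1) :
    ψ (WeilGroup.toAbsGalois F w) = 1 :=
  LocalKroneckerWeber.eq_one_of_canonicalArtin_eq_one ψ hψ
    (canonicalArtin_eq_one_of_lubinTateChar_eq_one hπ hw hχ)

include hπ in
/-- **Local Kronecker–Weber for continuous characters** of an arbitrary non-archimedean local
field: every continuous character `ψ : Γ_F → A` with values in a `T₁` abelian topological group is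
trivial on `I_F ∩ ker χ_π` — `ψ` factors through `Gal(F^{nr} · F_π / F)`.
[cite: CasselsFrohlichANT1967, Ch. VI §3.7 Thm. 3] [cite: LubinTate1965, Thm. 3 and Cor.] -/
theorem eq_one_of_mem_absInertia_of_lubinTateChar_eq_one {A : Type*} [CommGroup A]
    [TopologicalSpace A] [T1Space A] (ψ : absoluteGaloisGroup F →* A) (hψ : Continuous ψ)
    {σ : absoluteGaloisGroup F} (hσ : σ ∈ absInertia F) (hχ : lubinTateChar hπ σ = 1) : ψ σ = 1 := by
  have hmem : σ ∈ (WeilGroup.inertia F).map (WeilGroup.toAbsGalois F) := by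
    rw [WeilGroup.inertia_map_toAbsGalois]; exact hσ
  obtain ⟨w, hw, rfl⟩ := Subgroup.mem_map.mp hmem
  exact eq_one_of_mem_inertia_of_lubinTateChar_eq_one hπ ψ hψ hw hχ

include hπ in
/-- Two inertia elements with the same Lubin–Tate character have the same image under every
continuous character. [cite: CasselsFrohlichANT1967, Ch. VI §3.7 Thm. 3] -/
theorem apply_eq_of_mem_absInertia_of_lubinTateChar_eq {A : Type*} [CommGroup A]
    [TopologicalSpace A] [T1Space A] (ψ : absoluteGaloisGroup F →* A) (hψ : Continuous ψ)
    {τ τ' : absoluteGaloisGroup F} (hτ : τ ∈ absInertia F) (hτ' : τ' ∈ absInertia F)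
    (h : lubinTateChar hπ τ = lubinTateChar hπ τ') : ψ τ = ψ τ' := by
  have hmem : τ'⁻¹ * τ ∈ absInertia F := mul_mem (inv_mem hτ') hτ
  have hχ : lubinTateChar hπ (τ'⁻¹ * τ) = 1 := by
    rw [← lubinTateCharHom_apply, map_mul, map_inv, lubinTateCharHom_apply, lubinTateCharHom_apply, h,
      inv_mul_cancel]
  have h1 := eq_one_of_mem_absInertia_of_lubinTateChar_eq_one hπ ψ hψ hmem hχ
  rw [map_mul, map_inv, inv_mul_eq_one] at h1
  exact h1.symm

include hπ in
/-- **`χ_π(I_F) = 𝒪_Fˣ`, Weil-group form**: every unit `c` of `𝒪_F` is `χ_π(w)` for some `w` in the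
inertia subgroup of `W_F` — `c = Art_F(w)` for an inertial `w` (clause `image_inertia`) and
`χ_π(w) = Art_F(w)`. [cite: CasselsFrohlichANT1967, Ch. VI §3.7 Thm. 3] [cite: SerreLocalFields1979, Ch. XIII §4 Thm. 1] -/
theorem exists_mem_weilInertia_lubinTateChar_eq (c : 𝒪[F]ˣ) :
    ∃ w ∈ WeilGroup.inertia F, lubinTateChar hπ (WeilGroup.toAbsGalois F w) = c := by
  set u : Fˣ := Units.map (algebraMap 𝒪[F] F : 𝒪[F] →* F) c with hu
  have hval : valuation F (u : F) = 1 := by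
    have h1 : (u : F) = algebraMap 𝒪[F] F (c : 𝒪[F]) := by simp [hu]
    rw [h1]
    exact (Valuation.integer.integers (valuation F)).one_of_isUnit c.isUnit
  have hmem : u ∈ (valuation F).valuationSubring.unitGroup := by
    rw [Valuation.mem_unitGroup_iff]; exact hval
  rw [← (isLocalArtinMap_canonicalArtin_holds F).image_inertia, Subgroup.mem_map] at hmem
  obtain ⟨w, hw, hwu⟩ := hmem
  refine ⟨w, hw, ?_⟩
  have h := coe_lubinTateChar_toAbsGalois_canonicalArtin hπ hw
  rw [hwu] at h
  have h1 : (u : F) = ((c : 𝒪[F]) : F) := by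
    simp [hu]
    rfl
  exact Units.ext (Subtype.val_injective (h.trans h1))

include hπ in
/-- **`χ_π(I_F) = 𝒪_Fˣ`**: every unit of `𝒪_F` is the Lubin–Tate character of an element of the
inertia group `I_F ≤ Γ_F` (`F_π/F` is totally ramified with group `𝒪_Fˣ`).
[cite: CasselsFrohlichANT1967, Ch. VI §3.4 Thm. 3 (b)] [cite: LubinTate1965, Thm. 2] -/
theorem exists_mem_absInertia_lubinTateChar_eq (c : 𝒪[F]ˣ) :
    ∃ σ ∈ absInertia F, lubinTateChar hπ σ = c := by
  obtain ⟨w, hw, hχ⟩ := exists_mem_weilInertia_lubinTateChar_eq hπ c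
  exact ⟨WeilGroup.toAbsGalois F w, WeilGroup.mem_inertia_iff.mp hw, hχ⟩

include hπ in
/-- `χ_π : Γ_F → 𝒪_Fˣ` is surjective. [cite: CasselsFrohlichANT1967, Ch. VI §3.4 Thm. 3 (b)] -/
theorem lubinTateChar_surjective : Function.Surjective (lubinTateChar hπ) := fun c => by
  obtain ⟨σ, -, h⟩ := exists_mem_absInertia_lubinTateChar_eq hπ c
  exact ⟨σ, h⟩

include hπ in
/-- **The inertial part of a continuous character**: for every continuous character `ψ : Γ_F → A`
to a `T₁` abelian topological group there is a continuous character `ν` of `Γ_F` which agrees with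
`ψ` on the inertia group and is trivial on `ker χ_π` — `ν(σ) = ψ(τ)` for any `τ ∈ I_F` with
`χ_π(τ) = χ_π(σ)` (`ν⁻¹(C) = χ_π⁻¹(χ_π(I_F ∩ ψ⁻¹ C))` gives continuity).  Equivalently `ν` is
`ψ|_{I_F}` transported along `χ_π : I_F ↠ 𝒪_Fˣ ≅ Gal(F_π/F)`.
[cite: CasselsFrohlichANT1967, Ch. VI §3.7 Thm. 3] [cite: SerreLocalFields1979, Ch. XIII §4 Thm. 2] -/
theorem exists_continuous_character_eq_on_absInertia {A : Type*} [CommGroup A]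
    [TopologicalSpace A] [T1Space A] (ψ : absoluteGaloisGroup F →* A) (hψ : Continuous ψ) :
    ∃ ν : absoluteGaloisGroup F →* A, Continuous ν ∧
      (∀ σ ∈ absInertia F, ν σ = ψ σ) ∧
      (∀ σ, lubinTateChar hπ σ = 1 → ν σ = 1) ∧
      (∀ σ τ, τ ∈ absInertia F → lubinTateChar hπ τ = lubinTateChar hπ σ → ν σ = ψ τ) := by
  classical
  haveI : CompactSpace (absoluteGaloisGroup F) := absoluteGaloisGroup_compactSpace F
  set χ := lubinTateChar hπ with hχdef
  have hχc : Continuous χ := continuous_lubinTateCharHom hπ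
  have hχmul : ∀ a b, χ (a * b) = χ a * χ b := lubinTateChar_mul hπ
  haveI : T2Space F := (isLocalField F).toT2Space
  haveI : T2Space (𝒪[F])ˣ := Units.isEmbedding_embedProduct.t2Space
  -- inertial lifts of the values of `χ`
  have hlift : ∀ σ : absoluteGaloisGroup F, ∃ τ ∈ absInertia F, χ τ = χ σ := fun σ =>
    exists_mem_absInertia_lubinTateChar_eq hπ (χ σ)
  choose τ hτI hτχ using hlift
  have key : ∀ σ τ', τ' ∈ absInertia F → χ τ' = χ σ → ψ (τ σ) = ψ τ' := fun σ τ' h1 h2 =>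
    apply_eq_of_mem_absInertia_of_lubinTateChar_eq hπ ψ hψ (hτI σ) h1 ((hτχ σ).trans h2.symm)
  let ν : absoluteGaloisGroup F →* A :=
    { toFun := fun σ => ψ (τ σ)
      map_one' := by
        rw [key 1 1 (one_mem _) rfl]; exact map_one ψ
      map_mul' := fun a b => by
        have hmem : τ a * τ b ∈ absInertia F := mul_mem (hτI a) (hτI b)
        rw [key (a * b) (τ a * τ b) hmem (by rw [hχmul, hχmul, hτχ, hτχ]), map_mul] }
  have hν : ∀ σ, ν σ = ψ (τ σ) := fun _ => rfl
  refine ⟨ν, ?_, fun σ hσ => (hν σ).trans (key σ σ hσ rfl), fun σ h1 => ?_, fun σ τ' h1 h2 =>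
    (hν σ).trans (key σ τ' h1 h2)⟩
  · -- continuity: preimages of closed sets are closed
    refine continuous_iff_isClosed.mpr fun C hC => ?_
    have hK : IsCompact ((absInertia F : Set (absoluteGaloisGroup F)) ∩ ψ ⁻¹' C) :=
      ((isClosed_absInertia_holds F).inter (hC.preimage hψ)).isCompact
    have himg : IsClosed (χ ⁻¹' (χ '' ((absInertia F : Set (absoluteGaloisGroup F)) ∩ ψ ⁻¹' C))) :=
      ((hK.image hχc).isClosed).preimage hχc
    convert himg using 1
    ext σ
    simp only [Set.mem_preimage, Set.mem_image, Set.mem_inter_iff, SetLike.mem_coe]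
    constructor
    · intro h
      exact ⟨τ σ, ⟨hτI σ, by rwa [hν] at h⟩, hτχ σ⟩
    · rintro ⟨τ', ⟨hτ'I, hτ'C⟩, hτ'χ⟩
      rw [hν, key σ τ' hτ'I hτ'χ]
      exact hτ'C
  · rw [hν, key σ 1 (one_mem _) (by rw [h1, hχdef, lubinTateChar_one])]
    exact map_one ψ

include hπ in
/-- **Unramified × inertial decomposition**: every continuous character `ψ : Γ_F → A` of a
non-archimedean local field is `ψ = μ · ν` with `μ` continuous and unramified (trivial on `I_F`) and
`ν` continuous and trivial on `ker χ_π`.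
[cite: CasselsFrohlichANT1967, Ch. VI §3.7 Thm. 3] [cite: LubinTate1965, Thm. 3 and Cor.] -/
theorem exists_unramified_mul_inertial {A : Type*} [CommGroup A] [TopologicalSpace A]
    [IsTopologicalGroup A] [T1Space A] (ψ : absoluteGaloisGroup F →* A) (hψ : Continuous ψ) :
    ∃ μ ν : absoluteGaloisGroup F →* A, (∀ σ, ψ σ = μ σ * ν σ) ∧ Continuous μ ∧ Continuous ν ∧
      (∀ σ ∈ absInertia F, μ σ = 1) ∧ (∀ σ, lubinTateChar hπ σ = 1 → ν σ = 1) ∧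
      (∀ σ τ, τ ∈ absInertia F → lubinTateChar hπ τ = lubinTateChar hπ σ → ν σ = ψ τ) := by
  obtain ⟨ν, hνc, hνI, hνK, hνval⟩ := exists_continuous_character_eq_on_absInertia hπ ψ hψ
  refine ⟨ψ * ν⁻¹, ν, fun σ => ?_, ?_, hνc, fun σ hσ => ?_, hνK, hνval⟩
  · simp
  · exact hψ.mul hνc.inv
  · simp [hνI σ hσ]

include hπ in
/-- **Factorisation through the Lubin–Tate character.**  A continuous character `ν : Γ_F → A`
(`A` Hausdorff) trivial on `ker χ_π` is `ν = ν̃ ∘ χ_π` for a unique continuous homomorphism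
`ν̃ : 𝒪_Fˣ → A`: `χ_π : Γ_F ↠ 𝒪_Fˣ` is a continuous surjection of a compact space onto a Hausdorff
space, hence a quotient map. [cite: CasselsFrohlichANT1967, Ch. VI §3.4 Thm. 3 (b), §3.7 Thm. 3] -/
theorem exists_continuous_unitsHom_eq_comp_lubinTateChar {A : Type*} [CommGroup A]
    [TopologicalSpace A] [T2Space A] (ν : absoluteGaloisGroup F →* A) (hν : Continuous ν)
    (hνK : ∀ σ, lubinTateChar hπ σ = 1 → ν σ = 1) :
    ∃ νt : 𝒪[F]ˣ →* A, Continuous νt ∧ ∀ σ, ν σ = νt (lubinTateChar hπ σ) := by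
  classical
  haveI : CompactSpace (absoluteGaloisGroup F) := absoluteGaloisGroup_compactSpace F
  haveI : T2Space F := (isLocalField F).toT2Space
  haveI : T2Space (𝒪[F])ˣ := Units.isEmbedding_embedProduct.t2Space
  have hχc : Continuous (lubinTateChar hπ) := continuous_lubinTateCharHom hπ
  -- `ν` is constant on the fibres of `χ_π`
  have key : ∀ σ σ', lubinTateChar hπ σ = lubinTateChar hπ σ' → ν σ = ν σ' := by
    intro σ σ' h
    have h1 : lubinTateChar hπ (σ'⁻¹ * σ) = 1 := by
      rw [← lubinTateCharHom_apply, map_mul, map_inv, lubinTateCharHom_apply, lubinTateCharHom_apply, h,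
        inv_mul_cancel]
    have h2 := hνK _ h1
    rw [map_mul, map_inv, inv_mul_eq_one] at h2
    exact h2.symm
  choose s hs using lubinTateChar_surjective hπ
  let νt : 𝒪[F]ˣ →* A :=
    { toFun := fun c => ν (s c)
      map_one' := by rw [key (s 1) 1 (by rw [hs, lubinTateChar_one]), map_one]
      map_mul' := fun a b => by
        rw [key (s (a * b)) (s a * s b) (by rw [lubinTateChar_mul, hs, hs, hs]), map_mul] }
  have hcomp : ∀ σ, ν σ = νt (lubinTateChar hπ σ) := fun σ => key σ _ (by rw [hs])
  refine ⟨νt, ?_, hcomp⟩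
  -- `χ_π` is a quotient map
  have hq : Topology.IsQuotientMap (lubinTateChar hπ) :=
    (hχc.isClosedMap).isQuotientMap hχc (lubinTateChar_surjective hπ)
  rw [hq.continuous_iff]
  have : (νt : 𝒪[F]ˣ → A) ∘ lubinTateChar hπ = ν := funext fun σ => (hcomp σ).symm
  rw [this]
  exact hν

include hπ in
/-- **Local Kronecker–Weber decomposition through `𝒪_Fˣ`.**  Every continuous character
`ψ : Γ_F → A` (`A` a Hausdorff topological abelian group) is `ψ(σ) = μ(σ) · ν̃(χ_π(σ))` with `μ`
continuous unramified and `ν̃ : 𝒪_Fˣ → A` a continuous homomorphism; on the inertia subgroup of the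
Weil group, `ψ(w) = ν̃(χ_π(w))` and `χ_π(w) = Art_F(w)`.
[cite: CasselsFrohlichANT1967, Ch. VI §3.7 Thm. 3] [cite: LubinTate1965, Thm. 3 and Cor.]
[cite: SerreLocalFields1979, Ch. XIII §4 Thm. 2] -/
theorem exists_unramified_mul_unitsHom_comp_lubinTateChar {A : Type*} [CommGroup A]
    [TopologicalSpace A] [IsTopologicalGroup A] [T2Space A] (ψ : absoluteGaloisGroup F →* A)
    (hψ : Continuous ψ) :
    ∃ (μ : absoluteGaloisGroup F →* A) (νt : 𝒪[F]ˣ →* A), Continuous μ ∧ Continuous νt ∧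
      (∀ σ ∈ absInertia F, μ σ = 1) ∧ (∀ σ, ψ σ = μ σ * νt (lubinTateChar hπ σ)) ∧
      ∀ w ∈ WeilGroup.inertia F,
        ψ (WeilGroup.toAbsGalois F w) = νt (lubinTateChar hπ (WeilGroup.toAbsGalois F w)) ∧
          (((lubinTateChar hπ (WeilGroup.toAbsGalois F w) : 𝒪[F]ˣ) : 𝒪[F]) : F) = canonicalArtin F w := by
  obtain ⟨μ, ν, hψ', hμc, hνc, hμI, hνK, -⟩ := exists_unramified_mul_inertial hπ ψ hψ
  obtain ⟨νt, hνtc, hνt⟩ := exists_continuous_unitsHom_eq_comp_lubinTateChar hπ ν hνc hνK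
  refine ⟨μ, νt, hμc, hνtc, hμI, fun σ => by rw [hψ', hνt], fun w hw => ⟨?_, ?_⟩⟩
  · rw [hψ', hμI _ (WeilGroup.mem_inertia_iff.mp hw), one_mul, hνt]
  · exact coe_lubinTateChar_toAbsGalois_canonicalArtin hπ hw

end LocalKroneckerWeberLT

end Literature.NumberTheory.GaloisRepresentations

end
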